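import Mathlib
import Summits.QuantumFields.YangMills.Theorems.BalabanLadderIRTwistedSlabZeroFormGap
import Literature.Analysis.OperatorTheory.DiscreteHodgeDeterminant
import HarnessLib

/-!
# The linear model of the fluctuation operators at a twist-eating ladder: traceless fields, linear covariant differences, no zero mode of
# the Faddeev–Popov operator, and the Coulomb-slice determinant `det((Δ ⊗ 1)|ker div) = (det Δ)³` (lit-4's discrete Hodge determinant,
# instantiated on the `Fin` box — brick M2b of the T1-tree-exact roadmap)

HELPER toward stub **T1** `TwistedSlabAnchor` (LINE `twisted-slab-continuity`, crux `IRcof` stmt-QuantumFields-26930, census row 43;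
LEAD prover ym-ir-line-tsc-p1 g3; `--supports` the crux, `--as helper`).  Consumes `…TwistedSlabCovariantCalculus` ∕ `…ZeroFormGap` (K3a∕K3c)
and lit-4's `Literature.Analysis.OperatorTheory.DiscreteHodgeDeterminant` (p666635) BY NAME.
* §1 `tracelessFields` — the `ℂ`-submodule of `su`-type (traceless) matrix-valued site fields of the `Fin` box; `covDerivₗ U μ`, `covDerivAdjₗ U μ` —
  the forward covariant difference `∇⁺_μ = S_μ − 1` and its companion `S_μ† − 1` as LINEAR maps; both preserve tracelessness at a unitary background
  (`covDerivₗ_mem`, `covDerivAdjₗ_mem`); the restrictions `tracelessD`, `tracelessDadj : tracelessFields →ₗ[ℂ] tracelessFields`.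
* §2 the hypotheses of lit-4's determinant theorem at a PHASE-FLAT unitary background: `covDeriv_comm` (hDD), `covShiftAdj_comm` ∕ `covDerivAdj_comm`
  (hAA), `(H)` from `covDeriv_covDerivAdj_comm`; all three for the restricted maps (`tracelessD_comm`, `tracelessDadj_comm`, `tracelessD_Dadj_comm`).
* §3 ★ `covLaplacian_traceless_injective_ladder` ∕ `_bijective_ladder`: at the twist-eating ladder `![A, B, Γ₂, Γ₃]` (`A, B` a unitary Weyl pair,
  `ω` primitive, `N(m+1) ≥ 2`) the covariant Laplacian ∕ Faddeev–Popov operator `Δ = Σ_μ (S_μ† − 1)(S_μ − 1)` on traceless fields is BIJECTIVE (pairing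
  `Σ_x Re tr((ΔΦ)ᴴΦ) = Σ_μ Σ_x S(∇⁺_μ Φ)` + K3c's `eq_zero_of_covDeriv_ladder_eq_zero`).
* §4 ★★ `det_coulombSlice_ladder`: **`det((Δ ⊗ 1_4)|_{ker div}) = (det Δ)^3`** on the `Fin` box at the ladder (lit-4's `det_restrict_ker_covDiv` with
  `#ι = 4`): the one-loop Coulomb-slice determinant of the twisted slab reduces to the ghost determinant — three transverse polarisations.
NOT here (honest scope): the identification of `(Δ ⊗ 1)|_{ker div}` with the Hessian of the twisted Wilson action on the slice as an OPERATOR (K5 gives the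
quadratic forms on the diagonal; the polarisation + Riesz step in a Hilbert model of `tracelessFields ∩ ker div` is M1b), `det Δ` as a product over the
twisted momenta (g2's `…HarmonicDefect` endpoint), anything uniform in `β` (M3), the cluster expansion (M4); T1-box 0∕1, T1 proper 0∕1.

HONEST FRAMING: finite-dimensional linear algebra on one box; nothing here bears on `IRcof`, `IR`, or the Yang–Mills mass gap (Clay: NOT proved); R4 =
`BalabanLadder.UV` only.  References: M. García Pérez, A. González-Arroyo, M. Okawa, JHEP 10 (2017) 150 §2.5; I. Montvay, G. Münster, *Quantum Fields on a
Lattice* §3.3 (3.237)–(3.247).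
-/

set_option autoImplicit false

noncomputable section

open scoped Matrix
open Finset
open Literature.MathematicalPhysics.QuantumFieldTheory Literature.MathematicalPhysics.QuantumLattice
open Literature.Analysis.OperatorTheory

namespace Summit.QuantumFields.YangMills.Cruxes.IRcof.TwistedSlab

variable {N : ℕ} {n₀ n₁ n₂ n₃ : ℕ}

/-! ## §1 Traceless fields and the linear covariant differences -/

section Linear

variable (N n₀ n₁ n₂ n₃) in
/-- **The `ℂ`-submodule of traceless matrix-valued site fields** of the `Fin` box (the `su(N) ⊗ ℂ`-valued 0-forms; the domain on which the
twist-eating covariant Laplacian has no zero mode). [folklore] -/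
def tracelessFields : Submodule ℂ (FinTorusSite n₀ n₁ n₂ n₃ → Matrix (Fin N) (Fin N) ℂ) where
  carrier := {Φ | ∀ x, (Φ x).trace = 0}
  add_mem' := by
    intro a b ha hb x
    simp only [Set.mem_setOf_eq] at ha hb
    simp [Matrix.trace_add, ha x, hb x]
  zero_mem' := by intro x; simp
  smul_mem' := by
    intro c a ha x
    simp only [Set.mem_setOf_eq] at ha
    simp [Matrix.trace_smul, ha x]

/-- Membership in `tracelessFields`. [folklore] -/
theorem mem_tracelessFields {Φ : FinTorusSite n₀ n₁ n₂ n₃ → Matrix (Fin N) (Fin N) ℂ} :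
    Φ ∈ tracelessFields N n₀ n₁ n₂ n₃ ↔ ∀ x, (Φ x).trace = 0 := Iff.rfl

variable (U : FinTorusSite n₀ n₁ n₂ n₃ × Fin 4 → Matrix (Fin N) (Fin N) ℂ)

/-- **The forward covariant difference `∇⁺_μ = S_μ − 1` as a `ℂ`-linear map.** [folklore; GPGAO 2017 §2.3] -/
def covDerivₗ (μ : Fin 4) : (FinTorusSite n₀ n₁ n₂ n₃ → Matrix (Fin N) (Fin N) ℂ) →ₗ[ℂ] (FinTorusSite n₀ n₁ n₂ n₃ → Matrix (Fin N) (Fin N) ℂ) where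
  toFun := covDeriv U μ
  map_add' Φ Ψ := by
    funext x
    simp only [covDeriv, covShift, Pi.add_apply, Matrix.mul_add, Matrix.add_mul]
    abel
  map_smul' c Φ := by
    funext x
    simp only [covDeriv, covShift, Pi.smul_apply, Matrix.mul_smul, Matrix.smul_mul, smul_sub, RingHom.id_apply]

/-- **The companion `S_μ† − 1`** (minus the backward covariant difference) as a `ℂ`-linear map. [folklore; GPGAO 2017 §2.5] -/
def covDerivAdjₗ (μ : Fin 4) : (FinTorusSite n₀ n₁ n₂ n₃ → Matrix (Fin N) (Fin N) ℂ) →ₗ[ℂ] (FinTorusSite n₀ n₁ n₂ n₃ → Matrix (Fin N) (Fin N) ℂ) where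
  toFun Ψ := fun x => covShiftAdj U μ Ψ x - Ψ x
  map_add' Φ Ψ := by
    funext x
    simp only [covShiftAdj, Pi.add_apply, Matrix.mul_add, Matrix.add_mul]
    abel
  map_smul' c Φ := by
    funext x
    simp only [covShiftAdj, Pi.smul_apply, Matrix.mul_smul, Matrix.smul_mul, smul_sub, RingHom.id_apply]

/-- Unfolding lemma. [folklore] -/
@[simp] theorem covDerivₗ_apply (μ : Fin 4) (Φ : FinTorusSite n₀ n₁ n₂ n₃ → Matrix (Fin N) (Fin N) ℂ) : covDerivₗ U μ Φ = covDeriv U μ Φ := rfl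

/-- Unfolding lemma. [folklore] -/
@[simp] theorem covDerivAdjₗ_apply (μ : Fin 4) (Ψ : FinTorusSite n₀ n₁ n₂ n₃ → Matrix (Fin N) (Fin N) ℂ) :
    covDerivAdjₗ U μ Ψ = fun x => covShiftAdj U μ Ψ x - Ψ x := rfl

variable {U}

/-- `∇⁺_μ` preserves tracelessness (unitary background). [folklore] -/
theorem covDerivₗ_mem (hU : ∀ e, U e ∈ Matrix.unitaryGroup (Fin N) ℂ) (μ : Fin 4)
    {Φ : FinTorusSite n₀ n₁ n₂ n₃ → Matrix (Fin N) (Fin N) ℂ} (hΦ : Φ ∈ tracelessFields N n₀ n₁ n₂ n₃) :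
    covDerivₗ U μ Φ ∈ tracelessFields N n₀ n₁ n₂ n₃ := by
  intro x
  rw [covDerivₗ_apply, covDeriv, Matrix.trace_sub, trace_covShift hU, hΦ, hΦ, sub_self]

/-- `S_μ† − 1` preserves tracelessness (unitary background). [folklore] -/
theorem covDerivAdjₗ_mem (hU : ∀ e, U e ∈ Matrix.unitaryGroup (Fin N) ℂ) (μ : Fin 4)
    {Ψ : FinTorusSite n₀ n₁ n₂ n₃ → Matrix (Fin N) (Fin N) ℂ} (hΨ : Ψ ∈ tracelessFields N n₀ n₁ n₂ n₃) :
    covDerivAdjₗ U μ Ψ ∈ tracelessFields N n₀ n₁ n₂ n₃ := by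
  intro x
  have h2 : U (siteUnshift x μ, μ) * (U (siteUnshift x μ, μ))ᴴ = 1 := (hU _).2
  simp only [covDerivAdjₗ_apply, covShiftAdj, Matrix.trace_sub]
  rw [Matrix.trace_mul_cycle, h2, Matrix.one_mul, hΨ, hΨ, sub_self]

/-- **`∇⁺_μ` restricted to traceless fields.** [folklore] -/
def tracelessD (hU : ∀ e, U e ∈ Matrix.unitaryGroup (Fin N) ℂ) (μ : Fin 4) :
    tracelessFields N n₀ n₁ n₂ n₃ →ₗ[ℂ] tracelessFields N n₀ n₁ n₂ n₃ :=
  (covDerivₗ U μ).restrict fun _ hΦ => covDerivₗ_mem hU μ hΦ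

/-- **`S_μ† − 1` restricted to traceless fields.** [folklore] -/
def tracelessDadj (hU : ∀ e, U e ∈ Matrix.unitaryGroup (Fin N) ℂ) (μ : Fin 4) :
    tracelessFields N n₀ n₁ n₂ n₃ →ₗ[ℂ] tracelessFields N n₀ n₁ n₂ n₃ :=
  (covDerivAdjₗ U μ).restrict fun _ hΨ => covDerivAdjₗ_mem hU μ hΨ

/-- Underlying function of `tracelessD`. [folklore] -/
@[simp] theorem coe_tracelessD (hU : ∀ e, U e ∈ Matrix.unitaryGroup (Fin N) ℂ) (μ : Fin 4) (Φ : tracelessFields N n₀ n₁ n₂ n₃) :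
    ((tracelessD hU μ Φ : tracelessFields N n₀ n₁ n₂ n₃) : FinTorusSite n₀ n₁ n₂ n₃ → Matrix (Fin N) (Fin N) ℂ) = covDeriv U μ Φ := rfl

/-- Underlying function of `tracelessDadj`. [folklore] -/
@[simp] theorem coe_tracelessDadj (hU : ∀ e, U e ∈ Matrix.unitaryGroup (Fin N) ℂ) (μ : Fin 4) (Ψ : tracelessFields N n₀ n₁ n₂ n₃) :
    ((tracelessDadj hU μ Ψ : tracelessFields N n₀ n₁ n₂ n₃) : FinTorusSite n₀ n₁ n₂ n₃ → Matrix (Fin N) (Fin N) ℂ) =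
      fun x => covShiftAdj U μ Ψ x - (Ψ : FinTorusSite n₀ n₁ n₂ n₃ → Matrix (Fin N) (Fin N) ℂ) x := rfl

end Linear

/-! ## §2 The commutation hypotheses of the Hodge determinant at a phase-flat unitary background -/

section Commute

variable {U : FinTorusSite n₀ n₁ n₂ n₃ × Fin 4 → Matrix (Fin N) (Fin N) ℂ}

/-- `∇⁺_μ ∇⁺_ν = ∇⁺_ν ∇⁺_μ` at a phase-flat background (hDD). [folklore; GPGAO 2017 §2.3] -/
theorem covDeriv_comm (hflat : IsPhaseFlat U) (μ ν : Fin 4) (Φ : FinTorusSite n₀ n₁ n₂ n₃ → Matrix (Fin N) (Fin N) ℂ) :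
    covDeriv U μ (covDeriv U ν Φ) = covDeriv U ν (covDeriv U μ Φ) := by
  have h := congrFun (covShift_comm hflat μ ν Φ)
  funext x
  have e1 : covDeriv U μ (covDeriv U ν Φ) x = covShift U μ (covShift U ν Φ) x - covShift U μ Φ x - (covShift U ν Φ x - Φ x) := by
    show covShift U μ (fun y => covShift U ν Φ y - Φ y) x - (covShift U ν Φ x - Φ x) = _
    rw [congrFun (covShift_sub μ (covShift U ν Φ) Φ) x]
  have e2 : covDeriv U ν (covDeriv U μ Φ) x = covShift U ν (covShift U μ Φ) x - covShift U ν Φ x - (covShift U μ Φ x - Φ x) := by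
    show covShift U ν (fun y => covShift U μ Φ y - Φ y) x - (covShift U μ Φ x - Φ x) = _
    rw [congrFun (covShift_sub ν (covShift U μ Φ) Φ) x]
  rw [e1, e2, h x]
  abel

/-- `S_μ† S_ν† = S_ν† S_μ†` at a phase-flat unitary background. [folklore] -/
theorem covShiftAdj_comm (hU : ∀ e, U e ∈ Matrix.unitaryGroup (Fin N) ℂ) (hflat : IsPhaseFlat U) (μ ν : Fin 4)
    (Ψ : FinTorusSite n₀ n₁ n₂ n₃ → Matrix (Fin N) (Fin N) ℂ) :
    covShiftAdj U μ (covShiftAdj U ν Ψ) = covShiftAdj U ν (covShiftAdj U μ Ψ) := by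
  have hA : covShift U ν (covShift U μ (covShiftAdj U μ (covShiftAdj U ν Ψ))) = Ψ := by
    rw [covShift_covShiftAdj hU, covShift_covShiftAdj hU]
  have hB : covShift U ν (covShift U μ (covShiftAdj U ν (covShiftAdj U μ Ψ))) = Ψ := by
    rw [covShift_comm hflat ν μ, covShift_covShiftAdj hU, covShift_covShiftAdj hU]
  have h := hA.trans hB.symm
  have h' := congrArg (fun Φ => covShiftAdj U μ (covShiftAdj U ν Φ)) h
  simpa only [covShiftAdj_covShift hU] using h'

/-- `(S_μ† − 1)(S_ν† − 1) = (S_ν† − 1)(S_μ† − 1)` (hAA). [folklore] -/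
theorem covDerivAdj_comm (hU : ∀ e, U e ∈ Matrix.unitaryGroup (Fin N) ℂ) (hflat : IsPhaseFlat U) (μ ν : Fin 4)
    (Ψ : FinTorusSite n₀ n₁ n₂ n₃ → Matrix (Fin N) (Fin N) ℂ) :
    covDerivAdjₗ U μ (covDerivAdjₗ U ν Ψ) = covDerivAdjₗ U ν (covDerivAdjₗ U μ Ψ) := by
  have h := congrFun (covShiftAdj_comm hU hflat μ ν Ψ)
  funext x
  simp only [covDerivAdjₗ_apply]
  rw [congrFun (covShiftAdj_sub μ (covShiftAdj U ν Ψ) Ψ) x, congrFun (covShiftAdj_sub ν (covShiftAdj U μ Ψ) Ψ) x, h x]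
  abel

variable (hU : ∀ e, U e ∈ Matrix.unitaryGroup (Fin N) ℂ) (hflat : IsPhaseFlat U)
include hU hflat

/-- hDD for the restricted maps. [folklore] -/
theorem tracelessD_comm (μ ν : Fin 4) (Φ : tracelessFields N n₀ n₁ n₂ n₃) :
    tracelessD hU μ (tracelessD hU ν Φ) = tracelessD hU ν (tracelessD hU μ Φ) :=
  Subtype.ext (covDeriv_comm hflat μ ν Φ)

/-- hAA for the restricted maps. [folklore] -/
theorem tracelessDadj_comm (μ ν : Fin 4) (Ψ : tracelessFields N n₀ n₁ n₂ n₃) :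
    tracelessDadj hU μ (tracelessDadj hU ν Ψ) = tracelessDadj hU ν (tracelessDadj hU μ Ψ) :=
  Subtype.ext (covDerivAdj_comm hU hflat μ ν Ψ)

/-- (H) for the restricted maps. [folklore] -/
theorem tracelessD_Dadj_comm (μ ν : Fin 4) (Ψ : tracelessFields N n₀ n₁ n₂ n₃) :
    tracelessD hU μ (tracelessDadj hU ν Ψ) = tracelessDadj hU ν (tracelessD hU μ Ψ) :=
  Subtype.ext (covDeriv_covDerivAdj_comm hU hflat μ ν Ψ)

end Commute

/-! ## §3 No zero mode: the Faddeev–Popov operator on traceless fields is bijective at the twist-eating ladder -/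

section FP

variable {U : FinTorusSite n₀ n₁ n₂ n₃ × Fin 4 → Matrix (Fin N) (Fin N) ℂ}

/-- **The pairing identity** `Σ_x Re tr((ΔΦ)(x)ᴴ Φ(x)) = Σ_μ Σ_x S(∇⁺_μ Φ)(x)` for the covariant Laplacian of the restricted maps.
[folklore; GPGAO 2017 §2.5 (`−∇² = Σ ∇⁻∇⁺`)] -/
theorem sum_hsRe_covLaplacian (hU : ∀ e, U e ∈ Matrix.unitaryGroup (Fin N) ℂ) (Φ : tracelessFields N n₀ n₁ n₂ n₃) :
    ∑ x, (((((DiscreteWeitzenboeck.covLaplacian (tracelessD hU) (tracelessDadj hU) Φ : tracelessFields N n₀ n₁ n₂ n₃) :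
        FinTorusSite n₀ n₁ n₂ n₃ → Matrix (Fin N) (Fin N) ℂ) x)ᴴ * (Φ : FinTorusSite n₀ n₁ n₂ n₃ → Matrix (Fin N) (Fin N) ℂ) x).trace).re =
      ∑ μ, ∑ x, (((covDeriv U μ Φ x)ᴴ * covDeriv U μ Φ x).trace).re := by
  have hpt : ∀ x, (((DiscreteWeitzenboeck.covLaplacian (tracelessD hU) (tracelessDadj hU) Φ : tracelessFields N n₀ n₁ n₂ n₃) :
      FinTorusSite n₀ n₁ n₂ n₃ → Matrix (Fin N) (Fin N) ℂ) x) =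
      ∑ μ, (covShiftAdj U μ (covDeriv U μ Φ) x - covDeriv U μ Φ x) := by
    intro x
    rw [DiscreteWeitzenboeck.covLaplacian_apply, Submodule.coe_sum, Finset.sum_apply]
    rfl
  simp only [hpt, Matrix.conjTranspose_sum, Finset.sum_mul, Matrix.trace_sum, Complex.re_sum]
  rw [Finset.sum_comm]
  exact Finset.sum_congr rfl fun μ _ => sum_hsRe_covDerivAdj hU μ (covDeriv U μ Φ) Φ

/-- **A zero mode of the Faddeev–Popov operator is covariantly constant**: `ΔΦ = 0 ⇒ ∇⁺_μ Φ = 0` for all `μ` (unitary background; positivity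
of the pairing). [folklore; GPGAO 2017 §2.5] -/
theorem covDeriv_eq_zero_of_covLaplacian_eq_zero (hU : ∀ e, U e ∈ Matrix.unitaryGroup (Fin N) ℂ) (Φ : tracelessFields N n₀ n₁ n₂ n₃)
    (hΦ : DiscreteWeitzenboeck.covLaplacian (tracelessD hU) (tracelessDadj hU) Φ = 0) (μ : Fin 4) (x : FinTorusSite n₀ n₁ n₂ n₃) :
    covDeriv U μ (Φ : FinTorusSite n₀ n₁ n₂ n₃ → Matrix (Fin N) (Fin N) ℂ) x = 0 := by
  have hsum := sum_hsRe_covLaplacian hU Φ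
  have hL : ∀ y, (((DiscreteWeitzenboeck.covLaplacian (tracelessD hU) (tracelessDadj hU) Φ : tracelessFields N n₀ n₁ n₂ n₃) :
      FinTorusSite n₀ n₁ n₂ n₃ → Matrix (Fin N) (Fin N) ℂ) y) = 0 := fun y => by rw [hΦ]; rfl
  simp only [hL, Matrix.conjTranspose_zero, Matrix.zero_mul, Matrix.trace_zero, Complex.zero_re, Finset.sum_const_zero] at hsum
  have hnn : ∀ ν, 0 ≤ ∑ y, (((covDeriv U ν Φ y)ᴴ * covDeriv U ν Φ y).trace).re :=
    fun ν => Finset.sum_nonneg fun y _ => re_trace_conjTranspose_mul_self_nonneg _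
  have hzero := (Finset.sum_eq_zero_iff_of_nonneg fun ν _ => hnn ν).1 hsum.symm
  have hμ := (Finset.sum_eq_zero_iff_of_nonneg fun y _ => re_trace_conjTranspose_mul_self_nonneg (covDeriv U μ Φ y)).1
    (hzero μ (Finset.mem_univ μ)) x (Finset.mem_univ x)
  exact eq_zero_of_hsS_eq_zero hμ

variable [NeZero N] {m : ℕ} {A B : Matrix (Fin N) (Fin N) ℂ} {ω : ℂ}

/-- ★ **No zero mode of the Faddeev–Popov operator at the twist-eating ladder**: `Δ` is INJECTIVE on traceless fields (`A, B` a unitary Weyl pair,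
`ω` a primitive `N`-th root of unity, `N(m+1) ≥ 2`). [cite: GarciaperezGonzalezarroyoOkawa2017, §2.2 («the irreducibility condition eliminates the
presence of zero-modes»)] -/
theorem covLaplacian_traceless_injective_ladder {n₂' n₃' : ℕ} (hAu : A ∈ Matrix.unitaryGroup (Fin N) ℂ) (hBu : B ∈ Matrix.unitaryGroup (Fin N) ℂ)
    (hω : IsPrimitiveRoot ω N) (hAB : A * B = ω • (B * A)) {Γ₂ Γ₃ : Matrix (Fin N) (Fin N) ℂ} (hNm : 2 ≤ N * (m + 1))
    (hU : ∀ e, ladderField (n₀ := m + 1) (n₁ := m + 1) (n₂ := n₂') (n₃ := n₃') ![A, B, Γ₂, Γ₃] e ∈ Matrix.unitaryGroup (Fin N) ℂ) :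
    Function.Injective (DiscreteWeitzenboeck.covLaplacian (tracelessD hU) (tracelessDadj hU)) := by
  refine (injective_iff_map_eq_zero _).2 fun Φ hΦ => ?_
  have hflatΦ := covDeriv_eq_zero_of_covLaplacian_eq_zero hU Φ hΦ
  have htr : ∀ x, ((Φ : FinTorusSite (m + 1) (m + 1) n₂' n₃' → Matrix (Fin N) (Fin N) ℂ) x).trace = 0 := Φ.2
  have h := eq_zero_of_covDeriv_ladder_eq_zero (n₂ := n₂') (n₃ := n₃') hAu hBu hω hAB Γ₂ Γ₃ hNm htr hflatΦ
  exact Subtype.ext h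

/-- ★ **The Faddeev–Popov operator is BIJECTIVE** on traceless fields at the twist-eating ladder (injective endomorphism of a finite-dimensional space).
[cite: GarciaperezGonzalezarroyoOkawa2017, §2.5 (ghost propagator `1/q̂²`, no zero modes)] -/
theorem covLaplacian_traceless_bijective_ladder {n₂' n₃' : ℕ} (hAu : A ∈ Matrix.unitaryGroup (Fin N) ℂ) (hBu : B ∈ Matrix.unitaryGroup (Fin N) ℂ)
    (hω : IsPrimitiveRoot ω N) (hAB : A * B = ω • (B * A)) {Γ₂ Γ₃ : Matrix (Fin N) (Fin N) ℂ} (hNm : 2 ≤ N * (m + 1))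
    (hU : ∀ e, ladderField (n₀ := m + 1) (n₁ := m + 1) (n₂ := n₂') (n₃ := n₃') ![A, B, Γ₂, Γ₃] e ∈ Matrix.unitaryGroup (Fin N) ℂ) :
    Function.Bijective (DiscreteWeitzenboeck.covLaplacian (tracelessD hU) (tracelessDadj hU)) :=
  ⟨covLaplacian_traceless_injective_ladder hAu hBu hω hAB hNm hU,
    LinearMap.surjective_of_injective (covLaplacian_traceless_injective_ladder hAu hBu hω hAB hNm hU)⟩

end FP

/-! ## §4 The Coulomb-slice determinant at the ladder -/

section Determinant

variable [NeZero N] {m : ℕ} {A B : Matrix (Fin N) (Fin N) ℂ} {ω : ℂ}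

/-- ★★ **THE COULOMB-SLICE DETERMINANT OF THE TWISTED SLAB AT THE TWIST EATER: `det((Δ ⊗ 1_4)|_{ker div}) = (det Δ)^3`.**  At the ladder
`![A, B, Γ₂, Γ₃]` (`A, B` a unitary Weyl pair, `ω` a primitive `N`-th root of unity, the whole ladder unitary and PHASE-FLAT — e.g. `Γ₂, Γ₃` the decorated eaters
`c₂·1, c₃·1`; `N(m+1) ≥ 2`), on traceless fields of the box `(m+1)² × n₂ × n₃`: the
Feynman-gauge operator `Δ ⊗ 1` restricted to the Coulomb slice `ker div` has determinant `(det Δ)^3` — three transverse polarisations of the ghost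
operator (lit-4's `det_restrict_ker_covDiv` BY NAME, `#ι = 4`). [cite: GarciaperezGonzalezarroyoOkawa2017, §2.5] [cite: MontvayMunster1994, §3.3 (3.237)–(3.247)] -/
theorem det_coulombSlice_ladder {n₂' n₃' : ℕ} (hAu : A ∈ Matrix.unitaryGroup (Fin N) ℂ) (hBu : B ∈ Matrix.unitaryGroup (Fin N) ℂ)
    (hω : IsPrimitiveRoot ω N) (hAB : A * B = ω • (B * A)) {Γ₂ Γ₃ : Matrix (Fin N) (Fin N) ℂ} (hNm : 2 ≤ N * (m + 1))
    (hU : ∀ e, ladderField (n₀ := m + 1) (n₁ := m + 1) (n₂ := n₂') (n₃ := n₃') ![A, B, Γ₂, Γ₃] e ∈ Matrix.unitaryGroup (Fin N) ℂ)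
    (hflat : IsPhaseFlat (ladderField (n₀ := m + 1) (n₁ := m + 1) (n₂ := n₂') (n₃ := n₃') ![A, B, Γ₂, Γ₃])) :
    LinearMap.det (M := LinearMap.ker (DiscreteWeitzenboeck.covDiv (tracelessDadj hU)))
        ((DiscreteWeitzenboeck.formLaplacian (tracelessD hU) (tracelessDadj hU)).restrict
          fun _ ha => DiscreteWeitzenboeck.formLaplacian_mem_ker_covDiv (tracelessDadj_comm hU hflat) (tracelessD_Dadj_comm hU hflat) ha) =
      LinearMap.det (DiscreteWeitzenboeck.covLaplacian (tracelessD hU) (tracelessDadj hU)) ^ 3 := by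
  have h := DiscreteWeitzenboeck.det_restrict_ker_covDiv (tracelessD_comm hU hflat) (tracelessD_Dadj_comm hU hflat)
    (covLaplacian_traceless_bijective_ladder hAu hBu hω hAB hNm hU)
    fun _ ha => DiscreteWeitzenboeck.formLaplacian_mem_ker_covDiv (tracelessDadj_comm hU hflat) (tracelessD_Dadj_comm hU hflat) ha
  rw [Fintype.card_fin] at h
  exact h

/-- ★★ **The decorated twist-eating ladders `![A, B, c₂·1, c₃·1]`** (phases `c₂, c₃`, e.g. the centre labels `ω^i, ω^j` of K2's vacua): the Coulomb-slice
determinant is `(det Δ)^3`. [cite: GarciaperezGonzalezarroyoOkawa2017, §2.5] -/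
theorem det_coulombSlice_ladder_pair {n₂' n₃' : ℕ} (hAu : A ∈ Matrix.unitaryGroup (Fin N) ℂ) (hBu : B ∈ Matrix.unitaryGroup (Fin N) ℂ)
    (hω : IsPrimitiveRoot ω N) (hAB : A * B = ω • (B * A)) {c₂ c₃ : ℂ} (hNm : 2 ≤ N * (m + 1))
    (hU : ∀ e, ladderField (n₀ := m + 1) (n₁ := m + 1) (n₂ := n₂') (n₃ := n₃')
      ![A, B, c₂ • (1 : Matrix (Fin N) (Fin N) ℂ), c₃ • (1 : Matrix (Fin N) (Fin N) ℂ)] e ∈ Matrix.unitaryGroup (Fin N) ℂ) :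
    LinearMap.det (M := LinearMap.ker (DiscreteWeitzenboeck.covDiv (tracelessDadj hU)))
        ((DiscreteWeitzenboeck.formLaplacian (tracelessD hU) (tracelessDadj hU)).restrict
          fun _ ha => DiscreteWeitzenboeck.formLaplacian_mem_ker_covDiv
            (tracelessDadj_comm hU (isPhaseFlat_ladderField_pair (NeZero.ne N) hω.pow_eq_one hAB c₂ c₃))
            (tracelessD_Dadj_comm hU (isPhaseFlat_ladderField_pair (NeZero.ne N) hω.pow_eq_one hAB c₂ c₃)) ha) =
      LinearMap.det (DiscreteWeitzenboeck.covLaplacian (tracelessD hU) (tracelessDadj hU)) ^ 3 := by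
  exact det_coulombSlice_ladder hAu hBu hω hAB hNm hU (isPhaseFlat_ladderField_pair (NeZero.ne N) hω.pow_eq_one hAB c₂ c₃)

end Determinant

end Summit.QuantumFields.YangMills.Cruxes.IRcof.TwistedSlab

end
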